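import Mathlib
import HarnessLib

/-!
# Item `LrcModEntire` (stmt-NavierStokesRegularity-20428), registry twist_split v7 — rung (LL) of the «ridge quasiconvexity» lever (memo `Cruxes/LrcModEntire/T2B-g14.md` §9):
# LATERAL-LEVEL PERSISTENCE — the tube hypotheses of (Q1) hold for all times and heights near the hot ridge

LEAD of item 20428 ns-poloidal-K2-p3 g14 (`--supports stmt-NavierStokesRegularity-20428 --as helper`; sequel of `…RidgeQuasiconvex` (Q1, p704655)).

`…RidgeQuasiconvex.exists_end_ge_of_peakless` asks, for a tube chart `e` read at height `z₀` and time `s`, a level `m` with LATERAL values `< m` and CENTRE values `≥ m`.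
On a hot arc of the web `H ⊂ P₀` at `t = −1` one has `σv₂(−1,·) = N` on the centre curve and `< N` on the lateral boundary (it misses `H`).  This file supplies the
level for ALL `(t, z₀)` near `(−1, 0)` from nothing but JOINT CONTINUITY of `v` on the open backward slab (a class clause) and compactness:

* `lateralLevel_persist` — given `e`, `[a₁,a₂] × [−r,r] ⊆ e.source`, the plane-point maps `P z₀ q = (q.1, q.2, z₀)` (defining equation), strict lateral inequality and
  centre equality at `(t,z₀) = (−1,0)`: there are `δ > 0` and `m` such that for `|t+1| < δ`, `|z₀| < δ` the lateral values of `σv₂(t, P z₀ (e ·))` are `< m` and the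
  centre values are `≥ m` (`m = N − η`, `η` = half the lateral gap at `(−1,0)`; continuity of `sSup`/`sInf` over a compact set, `IsCompact.continuous_sSup`).

WHAT THIS IS NOT: not a claim about Navier–Stokes regularity — topology for the research stubs `stub_T2b` / `stub_C2a'` / `stub_C2b'` (bears_on LADDER-NS N0, item 20428 /
crux 19708; both OPEN, ⟨27893⟩ OPEN).
-/

noncomputable section

-- the summit and its single sub-problem share the name (CONVENTIONS §1), as in every Theorems file
set_option linter.dupNamespace false

namespace Summit.NavierStokesRegularity.NavierStokesRegularity.Theorems.PoloidalWindowDoorLrcModEntireLateralLevel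

open Set Filter Topology Metric Function

variable {v : ℝ → EuclideanSpace ℝ (Fin 3) → EuclideanSpace ℝ (Fin 3)}

/-- The time-clamped field `(t,y) ↦ v(min t (−1/2), y)` is jointly continuous on all of `ℝ × ℝ³` when `v` is jointly continuous on the open backward slab. -/
theorem continuous_clamp (hcont : ContinuousOn (uncurry v) (Iio (0 : ℝ) ×ˢ univ)) :
    Continuous fun p : ℝ × EuclideanSpace ℝ (Fin 3) => v (min p.1 (-1 / 2)) p.2 := by
  have h : Continuous fun p : ℝ × EuclideanSpace ℝ (Fin 3) => ((min p.1 (-1 / 2 : ℝ), p.2) : ℝ × EuclideanSpace ℝ (Fin 3)) := by fun_prop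
  have hmem : ∀ p : ℝ × EuclideanSpace ℝ (Fin 3), ((min p.1 (-1 / 2 : ℝ), p.2) : ℝ × EuclideanSpace ℝ (Fin 3)) ∈ Iio (0 : ℝ) ×ˢ (univ : Set _) :=
    fun p => ⟨by simp only [mem_Iio]; exact lt_of_le_of_lt (min_le_right _ _) (by norm_num), mem_univ _⟩
  exact hcont.comp_continuous h hmem

/-- **(LL) LATERAL-LEVEL PERSISTENCE.**  See the module docstring. -/
theorem lateralLevel_persist (hcont : ContinuousOn (uncurry v) (Iio (0 : ℝ) ×ˢ univ)) {σ N : ℝ}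
    (e : OpenPartialHomeomorph (ℝ × ℝ) (ℝ × ℝ)) {a₁ a₂ r : ℝ} (ha : a₁ ≤ a₂) (hsrc : Icc a₁ a₂ ×ˢ Icc (-r) r ⊆ e.source) (hr : 0 ≤ r)
    {P : ℝ → ℝ × ℝ → EuclideanSpace ℝ (Fin 3)} (hP : ∀ z₀ q, P z₀ q = WithLp.toLp 2 ![q.1, q.2, z₀])
    (hlat0 : ∀ a ∈ Icc a₁ a₂, ∀ n : ℝ, (n = r ∨ n = -r) → σ * v (-1) (P 0 (e (a, n))) 2 < N)
    (hmid0 : ∀ a ∈ Icc a₁ a₂, σ * v (-1) (P 0 (e (a, 0))) 2 = N) :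
    ∃ δ > 0, ∃ m : ℝ, ∀ t z₀ : ℝ, |t + 1| < δ → |z₀| < δ →
      (∀ a ∈ Icc a₁ a₂, ∀ n : ℝ, (n = r ∨ n = -r) → σ * v t (P z₀ (e (a, n))) 2 < m) ∧
      (∀ a ∈ Icc a₁ a₂, m ≤ σ * v t (P z₀ (e (a, 0))) 2) := by
  -- the jointly continuous integrand `f (t,z₀) q := σ · v(min t (−1/2), P z₀ q)₂`
  have hPc : Continuous fun p : ℝ × (ℝ × ℝ) => P p.1 p.2 := by
    have : (fun p : ℝ × (ℝ × ℝ) => P p.1 p.2) = fun p => WithLp.toLp 2 ![p.2.1, p.2.2, p.1] := funext fun p => hP p.1 p.2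
    rw [this]
    refine (PiLp.continuous_toLp 2 _).comp (continuous_pi fun i => ?_)
    fin_cases i <;> simp <;> fun_prop
  set f : ℝ × ℝ → ℝ × ℝ → ℝ := fun tz q => σ * v (min tz.1 (-1 / 2)) (P tz.2 q) 2 with hfdef
  have hfc : Continuous (uncurry f) := by
    have h1 : Continuous fun p : (ℝ × ℝ) × (ℝ × ℝ) => v (min p.1.1 (-1 / 2)) (P p.1.2 p.2) := by
      have hw := continuous_clamp hcont
      have hin : Continuous fun p : (ℝ × ℝ) × (ℝ × ℝ) => ((p.1.1, P p.1.2 p.2) : ℝ × EuclideanSpace ℝ (Fin 3)) :=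
        continuous_fst.fst.prodMk (hPc.comp (continuous_fst.snd.prodMk continuous_snd))
      exact hw.comp hin
    have h2 : Continuous fun p : (ℝ × ℝ) × (ℝ × ℝ) => (v (min p.1.1 (-1 / 2)) (P p.1.2 p.2)) 2 :=
      (EuclideanSpace.proj (𝕜 := ℝ) (2 : Fin 3)).continuous.comp h1
    exact continuous_const.mul h2
  -- the compact lateral and centre sets in chart-image coordinates
  set Klat : Set (ℝ × ℝ) := e '' (Icc a₁ a₂ ×ˢ ({r, -r} : Set ℝ)) with hKlat
  set Kmid : Set (ℝ × ℝ) := e '' (Icc a₁ a₂ ×ˢ ({0} : Set ℝ)) with hKmid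
  have hsub_lat : Icc a₁ a₂ ×ˢ ({r, -r} : Set ℝ) ⊆ e.source := by
    rintro q ⟨hq1, hq2⟩
    have h2 : q.2 = r ∨ q.2 = -r := by simpa [mem_insert_iff, mem_singleton_iff] using hq2
    refine hsrc ⟨hq1, ?_⟩
    rcases h2 with h | h <;> rw [h] <;> constructor <;> linarith
  have hsub_mid : Icc a₁ a₂ ×ˢ ({0} : Set ℝ) ⊆ e.source := fun q hq =>
    hsrc ⟨hq.1, by have h : q.2 = 0 := hq.2; rw [h]; exact ⟨by linarith, hr⟩⟩
  have hKlat_c : IsCompact Klat :=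
    (isCompact_Icc.prod (Set.toFinite _).isCompact).image_of_continuousOn (e.continuousOn.mono hsub_lat)
  have hKmid_c : IsCompact Kmid :=
    (isCompact_Icc.prod isCompact_singleton).image_of_continuousOn (e.continuousOn.mono hsub_mid)
  have hKlat_ne : Klat.Nonempty := ⟨e (a₁, r), (a₁, r), ⟨⟨le_rfl, ha⟩, by simp⟩, rfl⟩
  have hKmid_ne : Kmid.Nonempty := ⟨e (a₁, 0), (a₁, 0), ⟨⟨le_rfl, ha⟩, by simp⟩, rfl⟩
  -- the continuous envelope functions
  set g : ℝ × ℝ → ℝ := fun tz => sSup (f tz '' Klat) with hgdef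
  set h : ℝ × ℝ → ℝ := fun tz => sInf (f tz '' Kmid) with hhdef
  have hgc : Continuous g := hKlat_c.continuous_sSup (by exact hfc)
  have hhc : Continuous h := hKmid_c.continuous_sInf (by exact hfc)
  -- values at `(−1, 0)`: the clamp is inactive at `t = −1`
  have hclamp : ∀ t : ℝ, |t + 1| < 1 / 2 → min t (-1 / 2) = t := fun t ht => min_eq_left (by linarith [(abs_lt.1 ht).2])
  have hf0 : ∀ q, f (-1, 0) q = σ * v (-1) (P 0 q) 2 := fun q => by
    simp only [hfdef]; rw [hclamp (-1) (by norm_num)]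
  have hg0 : g (-1, 0) < N := by
    obtain ⟨q, hq, hqmax⟩ := (hKlat_c.image (hfc.uncurry_left (-1, 0))).sSup_mem (hKlat_ne.image _) |> fun hm => hm
    -- `g(−1,0) = f (−1,0) q` for some `q ∈ Klat`
    have : g (-1, 0) = f (-1, 0) q := hqmax.symm
    rw [this, hf0]
    obtain ⟨p, ⟨hp1, hp2⟩, rfl⟩ := hq
    have hp : p = (p.1, p.2) := rfl
    rw [hp]
    exact hlat0 p.1 hp1 p.2 (by simpa [or_comm] using hp2)
  have hh0 : h (-1, 0) = N := by
    apply le_antisymm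
    · have hle : h (-1, 0) ≤ f (-1, 0) (e (a₁, 0)) :=
        csInf_le (hKmid_c.image (hfc.uncurry_left (-1, 0))).bddBelow ⟨e (a₁, 0), ⟨(a₁, 0), ⟨⟨le_rfl, ha⟩, rfl⟩, rfl⟩, rfl⟩
      rw [hf0, hmid0 a₁ ⟨le_rfl, ha⟩] at hle
      exact hle
    · refine le_csInf (hKmid_ne.image _) ?_
      rintro x ⟨q, ⟨p, ⟨hp1, hp2⟩, rfl⟩, rfl⟩
      have hp : p = (p.1, 0) := by ext <;> simp [show p.2 = 0 from hp2]
      rw [hf0, hp, hmid0 p.1 hp1]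
  -- the gap and the neighbourhood
  set η : ℝ := (N - g (-1, 0)) / 2 with hη
  have hη0 : 0 < η := by rw [hη]; linarith
  have hev : ∀ᶠ tz in 𝓝 ((-1 : ℝ), (0 : ℝ)), g tz < N - η ∧ N - η < h tz := by
    have h1 : ∀ᶠ tz in 𝓝 ((-1 : ℝ), (0 : ℝ)), g tz < N - η :=
      hgc.continuousAt.eventually (gt_mem_nhds (by rw [hη]; linarith))
    have h2 : ∀ᶠ tz in 𝓝 ((-1 : ℝ), (0 : ℝ)), N - η < h tz :=
      hhc.continuousAt.eventually (lt_mem_nhds (by rw [hh0]; linarith))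
    exact h1.and h2
  obtain ⟨δ₀, hδ₀, hball⟩ := Metric.eventually_nhds_iff.1 hev
  refine ⟨min δ₀ (1 / 2), lt_min hδ₀ (by norm_num), N - η, fun t z₀ ht hz₀ => ?_⟩
  have htδ : |t + 1| < δ₀ := lt_of_lt_of_le ht (min_le_left _ _)
  have ht2 : |t + 1| < 1 / 2 := lt_of_lt_of_le ht (min_le_right _ _)
  have hzδ : |z₀| < δ₀ := lt_of_lt_of_le hz₀ (min_le_left _ _)
  have hdist : dist ((t, z₀) : ℝ × ℝ) ((-1 : ℝ), (0 : ℝ)) < δ₀ := by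
    rw [Prod.dist_eq, Real.dist_eq, Real.dist_eq, sub_zero, show t - -1 = t + 1 by ring]
    exact max_lt htδ hzδ
  obtain ⟨hgt, hht⟩ := hball hdist
  have hft : ∀ q, f (t, z₀) q = σ * v t (P z₀ q) 2 := fun q => by simp only [hfdef]; rw [hclamp t ht2]
  refine ⟨fun a ha' n hn => ?_, fun a ha' => ?_⟩
  · -- lateral: value ≤ g (t,z₀) < N − η
    have hmem : e (a, n) ∈ Klat := ⟨(a, n), ⟨ha', by rcases hn with rfl | rfl <;> simp⟩, rfl⟩
    have hle : f (t, z₀) (e (a, n)) ≤ g (t, z₀) :=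
      le_csSup (hKlat_c.image (hfc.uncurry_left (t, z₀))).bddAbove ⟨e (a, n), hmem, rfl⟩
    rw [hft] at hle
    exact lt_of_le_of_lt hle hgt
  · -- centre: value ≥ h (t,z₀) > N − η
    have hmem : e (a, 0) ∈ Kmid := ⟨(a, 0), ⟨ha', rfl⟩, rfl⟩
    have hle : h (t, z₀) ≤ f (t, z₀) (e (a, 0)) :=
      csInf_le (hKmid_c.image (hfc.uncurry_left (t, z₀))).bddBelow ⟨e (a, 0), hmem, rfl⟩
    rw [hft] at hle
    exact (le_of_lt hht).trans hle

end Summit.NavierStokesRegularity.NavierStokesRegularity.Theorems.PoloidalWindowDoorLrcModEntireLateralLevel
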